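import Mathlib
import Summits.NavierStokesRegularity.NavierStokesRegularity.Theorems.ThreadingFluxHorizonTowerQuadraticGeneratorOctic
import Summits.NavierStokesRegularity.NavierStokesRegularity.Theorems.ThreadingFluxHorizonTowerQuadraticGeneratorBrackets
import Summits.NavierStokesRegularity.NavierStokesRegularity.Theorems.ThreadingFluxHorizonTowerFiniteTowerClassPoly
import HarnessLib

/-!
# Crux `PoloidalLiouville` (stmt-NavierStokesRegularity-1222), crux idea «horizon-threading-tower» (ns-idea-15):
# THE QUADRATIC GENERATOR, VI — brackets with `C = 2145·π₈(L⁴)`, harmonicity of `W`, the class identity of the tower `{2, 6, 8}`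

Support file (`--supports stmt-NavierStokesRegularity-1222`, helper; cell `ns-wall-extremal`, width hand ns-wall-eng-3 g5; 0 kit), toward
THM F «the finite tower `{2, 6, 8}` is coaxially zonal at order one».  Real coefficients.

* generic `{P, C} = (8580 L³ − 6864 ρLM + 1320 τρ²L + 768 δρ³){P, L} + (−3432 ρL² + 1056 ρ²M − 144 τρ³){P, M}`;
* ★ `{B, C} = ρ W (−288288 L⁴ + ρ R)`, `R = −177408 L²M − 354816 ρM² + 118272 τρL² + 107520 τρ²M + 258048 δρ²L − 8064 τ²ρ³`:
  the bracket of the two top shells of a `{·, 6, 8}` tower has exactly ONE factor `ρ` and its SECOND DIGIT is `−288288 · W · L⁴`;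
* `lapP_genW`: `W = det(x, Qx, Q²x)` is harmonic;
* ★ the class identity of the tower `{2, 6, 8}` (`N = 14`; from `finiteTower_classPoly_eq_zero`):
  `5 {P₆, P₈} + 11 ρ² {P₂, P₈} + 6 ρ³ {P₂, P₆} = 0` — the competitors of the top pair enter only at `ρ²`.

HONEST LABEL: polynomial identities about one crux idea's typed objects; no Prop of the sketch is closed here; `HorizonTowerZonality`
(general towers), `PoloidalLiouville` (1222) OPEN; NS regularity NOT proved.  [folklore]
-/

-- the summit and its single sub-problem share the name (CONVENTIONS §1)
set_option linter.dupNamespace false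

noncomputable section

open MvPolynomial
open scoped RealInnerProductSpace
open Literature.Analysis.FluidPDE (cross)
open Literature.Geometry.DiscreteGeometry (inner_fin3 norm_sq_fin3)

namespace Summit.NavierStokesRegularity.NavierStokesRegularity.Theorems.PoloidalLiouville.HorizonTower.Zonal

variable (a b d e f : ℝ)

/-! ### Brackets with `C` -/

/-- `{P, C}` for a general first slot. [folklore] -/
theorem detP_genC_right (P : RPoly) : detP P (genC a b d e f)
    = (C 8580 * genL a b d e f ^ 3 - C 6864 * normSq * genL a b d e f * genM a b d e f
        + C (1320 * genTau a b d e f) * normSq ^ 2 * genL a b d e f + C (768 * genDelta a b d e f) * normSq ^ 3)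
        * detP P (genL a b d e f)
      + (-(C 3432 * normSq * genL a b d e f ^ 2) + C 1056 * normSq ^ 2 * genM a b d e f
        - C (144 * genTau a b d e f) * normSq ^ 3) * detP P (genM a b d e f) := by
  unfold genC
  simp only [detP_add_right, detP_sub_right, detP_mul_right, detP_normSq_right, detP_C_right, pow_succ, pow_zero, one_mul,
    mul_zero, add_zero]
  simp only [map_ofNat, map_mul]
  ring

/-- `{L, C} = 4W(−3432 ρL² + 1056 ρ²M − 144 τρ³)`. [folklore] -/
theorem detP_genL_genC : detP (genL a b d e f) (genC a b d e f)
    = C 4 * genW a b d e f * (-(C 3432 * normSq * genL a b d e f ^ 2) + C 1056 * normSq ^ 2 * genM a b d e f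
        - C (144 * genTau a b d e f) * normSq ^ 3) := by
  rw [detP_genC_right, detP_self, detP_genL_genM]; ring

/-- `{M, C} = −4W(8580 L³ − 6864 ρLM + 1320 τρ²L + 768 δρ³)`. [folklore] -/
theorem detP_genM_genC : detP (genM a b d e f) (genC a b d e f)
    = -(C 4 * genW a b d e f * (C 8580 * genL a b d e f ^ 3 - C 6864 * normSq * genL a b d e f * genM a b d e f
        + C (1320 * genTau a b d e f) * normSq ^ 2 * genL a b d e f + C (768 * genDelta a b d e f) * normSq ^ 3)) := by
  rw [detP_genC_right, detP_self, detP_genM_genL]; ring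

/-- ★ `{B, C} = ρ W (−288288 L⁴ + ρ R)`: exactly ONE factor `ρ`; the second digit is `−288288 · W · L⁴`. [folklore] -/
theorem detP_genB_genC : detP (genB a b d e f) (genC a b d e f)
    = normSq * genW a b d e f * (-(C 288288 * genL a b d e f ^ 4)
      + normSq * (-(C 177408 * genL a b d e f ^ 2 * genM a b d e f) - C 354816 * normSq * genM a b d e f ^ 2
        + C (118272 * genTau a b d e f) * normSq * genL a b d e f ^ 2 + C (107520 * genTau a b d e f) * normSq ^ 2 * genM a b d e f
        + C (258048 * genDelta a b d e f) * normSq ^ 2 * genL a b d e f - C (8064 * genTau a b d e f ^ 2) * normSq ^ 3)) := by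
  have hL := detP_genL_genC a b d e f
  have hM := detP_genM_genC a b d e f
  unfold genB
  simp only [detP_add_left, detP_sub_left, detP_mul_left, detP_normSq_left, detP_C_left, hL, hM, pow_succ, pow_zero,
    one_mul, mul_zero, add_zero]
  simp only [map_ofNat, map_mul]
  ring

/-! ### `W` is harmonic -/

/-- `W = det(x, Qx, Q²x)` is a harmonic cubic. [folklore] -/
theorem lapP_genW : lapP (genW a b d e f) = 0 := by
  simp only [genW, genS0, genS1, genS2, genQ0, genQ1, genQ2, lapP, map_add, map_sub, Derivation.leibniz, pderiv_C,
    pderiv_X_self, pderiv_X_of_ne (show (1 : Fin 3) ≠ 0 by decide), pderiv_X_of_ne (show (2 : Fin 3) ≠ 0 by decide),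
    pderiv_X_of_ne (show (0 : Fin 3) ≠ 1 by decide), pderiv_X_of_ne (show (2 : Fin 3) ≠ 1 by decide),
    pderiv_X_of_ne (show (0 : Fin 3) ≠ 2 by decide), pderiv_X_of_ne (show (1 : Fin 3) ≠ 2 by decide),
    smul_eq_mul, map_zero, mul_zero, add_zero, zero_add, sub_zero, mul_one]
  ring

end Summit.NavierStokesRegularity.NavierStokesRegularity.Theorems.PoloidalLiouville.HorizonTower.Zonal

namespace Summit.NavierStokesRegularity.NavierStokesRegularity.Theorems.PoloidalLiouville.HorizonTower

/-! ### The class identity of the tower `{2, 6, 8}` -/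

/-- ★ **THE CLASS IDENTITY OF THE TOWER `{2, 6, 8}`**: for polynomial models `P₂, P₆, P₈` of the shells of a scale-free tower
`U_{H₂} + U_{H₆} + U_{H₈}` annihilated by the order-one horizon law off the centre,
`5 {P₆, P₈} + 11 ρ² {P₂, P₈} + 6 ρ³ {P₂, P₆} = 0`. [folklore] -/
theorem finiteTower_classIdentity_twoSixEight (H : ℕ → E3 → ℝ)
    (hH : ∀ l ∈ ({2, 6, 8} : Finset ℕ), ContDiff ℝ (⊤ : ℕ∞) (H l))
    (hhom : ∀ l ∈ ({2, 6, 8} : Finset ℕ), ∀ (c : ℝ) (y : E3), H l (c • y) = c ^ l * H l y)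
    (hharm : ∀ l ∈ ({2, 6, 8} : Finset ℕ), ∀ y, Laplacian.laplacian (H l) y = 0)
    (hL1 : ∀ x : E3, x ≠ 0 → horizonL1 (fun z => ∑ l ∈ ({2, 6, 8} : Finset ℕ), horizonProfile l (H l) 0 z) 0 x = 0)
    (P : ℕ → MvPolynomial (Fin 3) ℝ) (hP : ∀ l ∈ ({2, 6, 8} : Finset ℕ), ∀ y, H l y = Zonal.evalE (P l) y) :
    C 5 * Zonal.detP (P 6) (P 8) + C 11 * Zonal.normSq ^ 2 * Zonal.detP (P 2) (P 8)
      + C 6 * Zonal.normSq ^ 3 * Zonal.detP (P 2) (P 6) = 0 := by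
  classical
  have hK : ∀ l ∈ ({2, 6, 8} : Finset ℕ), 1 ≤ l := by
    intro l hl
    simp only [Finset.mem_insert, Finset.mem_singleton] at hl
    omega
  have h := finiteTower_classPoly_eq_zero {2, 6, 8} H hK hH hhom hharm hL1 P hP 14 (by
    intro j hj k hk hjk
    simp only [Finset.mem_insert, Finset.mem_singleton] at hj hk
    rcases hj with rfl | rfl | rfl <;> rcases hk with rfl | rfl | rfl <;> first | omega | exact Zonal.detP_self' _)
  have h26 : (2 : ℕ) ∉ ({6, 8} : Finset ℕ) := by decide
  have h68 : (6 : ℕ) ∉ ({8} : Finset ℕ) := by decide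
  simp only [Finset.sum_insert h26, Finset.sum_insert h68, Finset.sum_singleton] at h
  norm_num at h
  rw [Zonal.detP_antisymm (P 2) (P 6), Zonal.detP_antisymm (P 2) (P 8), Zonal.detP_antisymm (P 6) (P 8)] at h
  have h12 : (C (-12 : ℝ) : MvPolynomial (Fin 3) ℝ) ≠ 0 := by rw [Ne, C_eq_zero]; norm_num
  have key : C (-12 : ℝ) * (C 5 * Zonal.detP (P 6) (P 8) + C 11 * Zonal.normSq ^ 2 * Zonal.detP (P 2) (P 8)
      + C 6 * Zonal.normSq ^ 3 * Zonal.detP (P 2) (P 6)) = 0 := by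
    rw [← h, Zonal.normSq]
    simp only [map_neg, map_ofNat]
    ring
  exact (mul_eq_zero.mp key).resolve_left h12

end Summit.NavierStokesRegularity.NavierStokesRegularity.Theorems.PoloidalLiouville.HorizonTower

end
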